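import Summits.QuantumFields.QCD.Theses.PauliWegnerSea
import Literature.MathematicalPhysics.QuantumFieldTheory.QCDCurrentSector
import Literature.MathematicalPhysics.QuantumFieldTheory.QCDTimeReflection
import Summits.QuantumFields.QCD.Theorems.SpectralDefectExtinctionWindowExtinctionChessboardTransferFragments
import Literature.MathematicalPhysics.QuantumFieldTheory.QCDTorusTranslation
import Literature.MathematicalPhysics.QuantumFieldTheory.QCDTimeReflectionProofs
import Literature.MathematicalPhysics.QuantumLattice.GrassmannGaussianSymmetry

/-!
# Stub `stub_apTranslation` of line `log-convex-continuum-lift`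
(crux `PauliWegnerSea.ChiralOneScaleTrajectory`, stmt-QuantumFields-17512, registered stub
`stub_apTranslation` of skeleton v2 `Cruxes/ChiralOneScaleTrajectory/Lines/log_convex_continuum_lift.lean`)

**Translation invariance of the un-normalised time-ANTIPERIODIC two-bilinear functional** on the odd
four-torus `2S+1` (every `β`, all masses, flavours, spin matrices, sites `x y`, torus vectors `u`):
`∫dμ_W ∫dψ̄dψ (ψ̄_f Γ ψ_g)(x) (ψ̄_{f'} Γ' ψ_{g'})(y) e^{−ψ̄ D_AP(U) ψ}` is unchanged under
`(x, y) ↦ (x + u, y + u)` — the antiperiodic twin of `QCDTorusTranslation.qcdTorusExpect_quarkTranslate`.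

Proof.  The invariant translations are closed under `+`, so the unit vectors `e_μ` suffice.  Substitute
`U ↦ τ_u U` (`integral_comp_torusConfigShift_wilson`) and relabel the quarks by `u` (`quarkTranslate`,
`fermiIntegral_quarkTranslate`).  `D_AP` is NOT covariant: `apLinkSign` sits on ONE layer of temporal
links, and `D_AP(τ_u U)_{pq} = σ(p) σ(q) D_AP(U)_{p−u,q−u}` for a `ℤ₂` site function `σ` (`σ ≡ 1` for
spatial `u`; `σ(x) = apLinkSign(x − e₀)` for `u = e₀`: the slice above the layer flips;
`diracMatrixAP_torusConfigShift_sign`).  The diagonal substitution `ψ̄_p ↦ σ(p)ψ̄_p`, `ψ_p ↦ σ(p)ψ_p`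
(`blockSubst` with equal diagonal blocks) has Berezin Jacobian `(∏σ)² = 1`, maps `e^{ψ̄Aψ}` to
`e^{ψ̄ σAσ ψ}` and fixes equal-site bilinears, which absorbs the conjugation.

Sources: I. Montvay, G. Münster, *Quantum Fields on a Lattice* (CUP 1994), §4.1 (4.21), §4.2.4 (4.112)–(4.115)
(boundary sign factors; moving the antiperiodic layer = `ψ ↦ −ψ` on the slices in between), §5.1;
F. A. Berezin, *The Method of Second Quantization* (1966), Ch. I §3 (Berezin change of variables).
-/

noncomputable section

-- keep this namespace prefix; the LAST component is yours (one sub-namespace per stub file)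
namespace Summit.QuantumFields.QCD.Cruxes.ChiralOneScaleTrajectory.LogConvexLift.APTranslation

open scoped BigOperators Topology ComplexOrder
open MeasureTheory Filter
open Literature.MathematicalPhysics.QuantumFieldTheory Literature.MathematicalPhysics.QuantumLattice
  Literature.Probability.LatticeModels

/-! ### NOTATION PRELUDE (paste verbatim into every stub work file; expands to tree declarations only)

* `nAP⟪β, S, mq, f, g, v⟫` — UN-normalised antiperiodic flavoured pion numerator on the torus of side `2S+1`:
  `∫dμ_W(β) ∫dψ̄dψ (ψ̄_g γ₅ ψ_f)(0) · (ψ̄_f γ₅ ψ_g)(v) · e^{−ψ̄ D_AP(U) ψ}` (`v : Site 4`, read mod `2S+1`);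
* `nP⟪…⟫` — the same with the Statement's time-PERIODIC `fermiBoltzmann`;
* `zAP⟪β, S, mq⟫`, `zP⟪β, S, mq⟫` — the two partition functions;
* `dAP⟪β, S, mq, f, g, T, h, n⟫` — the source-and-sink smeared trace `𝒟_h(n) = Σ_{z,z' ∈ T} h z h z' N_AP(n e₀ + z' − z)`
  for a real profile `h` on the finite set `T` of (spatial) sites;
* `APTI⟪Nf⟫`, `TP⟪Nf⟫`, `CHORD`, `LOGROOM⟪reg⟫`, `TWIST⟪Nf, reg⟫`, `LIGHT⟪Nf, reg⟫` — the Props of the stubs. -/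

local notation "SU3" => Matrix.specialUnitaryGroup (Fin 3) ℂ

local notation "nAP⟪" β ", " S ", " mq ", " f ", " g ", " v "⟫" =>
  (∫ U : GaugeConfig 4 (2 * S + 1) (Matrix.specialUnitaryGroup (Fin 3) ℂ),
      fermiIntegral (torusBilinear g f (Torus.proj (2 * S + 1) 0) (Torus.proj (2 * S + 1) 0) gammaFive 1 *
          torusBilinear f g (Torus.proj (2 * S + 1) v) (Torus.proj (2 * S + 1) v) gammaFive 1 *
        fermiBoltzmannAP U mq)
    ∂(wilsonMeasure (fundamentalRep (Fin 3)) β))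

local notation "nP⟪" β ", " S ", " mq ", " f ", " g ", " v "⟫" =>
  (∫ U : GaugeConfig 4 (2 * S + 1) (Matrix.specialUnitaryGroup (Fin 3) ℂ),
      fermiIntegral (torusBilinear g f (Torus.proj (2 * S + 1) 0) (Torus.proj (2 * S + 1) 0) gammaFive 1 *
          torusBilinear f g (Torus.proj (2 * S + 1) v) (Torus.proj (2 * S + 1) v) gammaFive 1 *
        fermiBoltzmann U mq)
    ∂(wilsonMeasure (fundamentalRep (Fin 3)) β))

local notation "zAP⟪" β ", " S ", " mq "⟫" =>
  (∫ U : GaugeConfig 4 (2 * S + 1) (Matrix.specialUnitaryGroup (Fin 3) ℂ),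
      fermiIntegral (fermiBoltzmannAP U mq) ∂(wilsonMeasure (fundamentalRep (Fin 3)) β))

local notation "zP⟪" β ", " S ", " mq "⟫" =>
  (∫ U : GaugeConfig 4 (2 * S + 1) (Matrix.specialUnitaryGroup (Fin 3) ℂ),
      fermiIntegral (fermiBoltzmann U mq) ∂(wilsonMeasure (fundamentalRep (Fin 3)) β))

local notation "dAP⟪" β ", " S ", " mq ", " f ", " g ", " T ", " h ", " n "⟫" =>
  (∑ z ∈ (T : Finset (Literature.Probability.LatticeModels.Site 4)),
    ∑ z' ∈ (T : Finset (Literature.Probability.LatticeModels.Site 4)),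
      (((h : Literature.Probability.LatticeModels.Site 4 → ℝ) z * h z' : ℝ) : ℂ) *
        nAP⟪β, S, mq, f, g, (Pi.single (0 : Fin 4) (((n : ℕ) : ℤ)) + (z' - z))⟫)

-- `APTI⟪Nf⟫`: translation invariance of the un-normalised antiperiodic two-bilinear functional.
set_option quotPrecheck false in
local notation "APTI⟪" Nf "⟫" =>
  (∀ (β : ℝ) (S : ℕ) (mq : Fin Nf → ℝ) (f g f' g' : Fin Nf) (Γ Γ' : Matrix (Fin 4) (Fin 4) ℂ)
      (x y u : TorusSite 4 (2 * S + 1)),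
    (∫ U : GaugeConfig 4 (2 * S + 1) (Matrix.specialUnitaryGroup (Fin 3) ℂ),
        fermiIntegral (torusBilinear f g x x Γ 1 * torusBilinear f' g' y y Γ' 1 * fermiBoltzmannAP U mq)
      ∂(wilsonMeasure (fundamentalRep (Fin 3)) β)) =
    ∫ U : GaugeConfig 4 (2 * S + 1) (Matrix.specialUnitaryGroup (Fin 3) ℂ),
        fermiIntegral (torusBilinear f g (x + u) (x + u) Γ 1 * torusBilinear f' g' (y + u) (y + u) Γ' 1 *
          fermiBoltzmannAP U mq)
      ∂(wilsonMeasure (fundamentalRep (Fin 3)) β))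

-- `TP⟪Nf⟫`: the RP–Hankel form of transfer positivity (even separations, phase `u`).
set_option quotPrecheck false in
local notation "TP⟪" Nf "⟫" =>
  (∀ (β : ℝ), 0 ≤ β → ∀ (S : ℕ), 1 ≤ S → ∀ (mq : Fin Nf → ℝ), (∀ fl, -1 < mq fl) → ∀ (f g : Fin Nf),
    ∃ u : ℂ, ‖u‖ = 1 ∧
      (∀ (T : Finset (Literature.Probability.LatticeModels.Site 4)) (h : Literature.Probability.LatticeModels.Site 4 → ℝ),
        (∀ z ∈ T, z 0 = 0 ∧ ∀ i, |z i| ≤ (S : ℤ)) →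
        ∀ (s t : ℕ), 1 ≤ s → s ≤ S → 1 ≤ t → t ≤ S →
          0 ≤ u * dAP⟪β, S, mq, f, g, T, h, 2 * s⟫ ∧
          ‖dAP⟪β, S, mq, f, g, T, h, s + t⟫‖ ^ 2 ≤
            (u * dAP⟪β, S, mq, f, g, T, h, 2 * s⟫).re * (u * dAP⟪β, S, mq, f, g, T, h, 2 * t⟫).re) ∧
      (∀ (t : ℕ) (w : Literature.Probability.LatticeModels.Site 4), 1 ≤ t → t ≤ S → w 0 = 0 →
        (∀ i, |w i| ≤ (S : ℤ)) →
          ‖nAP⟪β, S, mq, f, g, (Pi.single (0 : Fin 4) (((2 * t : ℕ) : ℤ)) + w)⟫‖ ≤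
            (u * nAP⟪β, S, mq, f, g, (Pi.single (0 : Fin 4) (((2 * t : ℕ) : ℤ)))⟫).re))

-- `CHORD`: local log-convexity of a non-negative finite sequence gives the three-point chord inequality.
set_option quotPrecheck false in
local notation "CHORD" =>
  (∀ (e : ℕ → ℝ) (N : ℕ), (∀ j, 1 ≤ j → j ≤ N → 0 ≤ e j) →
    (∀ j, 2 ≤ j → j + 1 ≤ N → e j ^ 2 ≤ e (j - 1) * e (j + 1)) →
    ∀ i j k : ℕ, 1 ≤ i → i < j → j < k → k ≤ N → e j ^ (k - i) ≤ e i ^ (k - j) * e k ^ (j - i))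

-- `LOGROOM⟪reg⟫`: superlogarithmic physical volume.
set_option quotPrecheck false in
local notation "LOGROOM⟪" reg "⟫" =>
  (Tendsto (fun k => QCDRegularisation.a reg k * (QCDRegularisation.L reg k : ℝ) /
    (1 + |Real.log (QCDRegularisation.a reg k)|)) atTop atTop)

-- `TWIST⟪Nf, reg⟫`: the `(−1)^F` twist is invisible at log-scale separations, at `S = L_k`, eventually.
set_option quotPrecheck false in
local notation "TWIST⟪" Nf ", " reg "⟫" =>
  (∀ (m : Fin Nf → ℝ), (∀ fl, 0 < m fl) → ∀ (f g : Fin Nf), f ≠ g → ∀ K : ℝ, ∀ᶠ k in atTop,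
    2 * ‖zAP⟪QCDRegularisation.β reg k, QCDRegularisation.L reg k,
            fun fl => QCDRegularisation.mcrit reg k + QCDRegularisation.a reg k * m fl / QCDRegularisation.Zm reg k⟫ -
          zP⟪QCDRegularisation.β reg k, QCDRegularisation.L reg k,
            fun fl => QCDRegularisation.mcrit reg k + QCDRegularisation.a reg k * m fl / QCDRegularisation.Zm reg k⟫‖ ≤
      ‖zAP⟪QCDRegularisation.β reg k, QCDRegularisation.L reg k,
          fun fl => QCDRegularisation.mcrit reg k + QCDRegularisation.a reg k * m fl / QCDRegularisation.Zm reg k⟫‖ ∧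
    ∀ n : ℕ, (n : ℝ) * QCDRegularisation.a reg k ≤ K * (1 + |Real.log (QCDRegularisation.a reg k)|) →
      2 * ‖nAP⟪QCDRegularisation.β reg k, QCDRegularisation.L reg k,
              fun fl => QCDRegularisation.mcrit reg k + QCDRegularisation.a reg k * m fl / QCDRegularisation.Zm reg k,
              f, g, (Pi.single (0 : Fin 4) ((n : ℕ) : ℤ))⟫ -
            nP⟪QCDRegularisation.β reg k, QCDRegularisation.L reg k,
              fun fl => QCDRegularisation.mcrit reg k + QCDRegularisation.a reg k * m fl / QCDRegularisation.Zm reg k,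
              f, g, (Pi.single (0 : Fin 4) ((n : ℕ) : ℤ))⟫‖ ≤
        ‖nAP⟪QCDRegularisation.β reg k, QCDRegularisation.L reg k,
            fun fl => QCDRegularisation.mcrit reg k + QCDRegularisation.a reg k * m fl / QCDRegularisation.Zm reg k,
            f, g, (Pi.single (0 : Fin 4) ((n : ℕ) : ℤ))⟫‖)

-- `LIGHT⟪Nf, reg⟫`: LatticeLightness at EVEN lattice times `2n₁ < 2n₂` within a fixed physical distance, with a
-- polynomial floor relative to `‖Z_AP‖ > 0`, frequently in `k`, at `S = L_k`.
set_option quotPrecheck false in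
local notation "LIGHT⟪" Nf ", " reg "⟫" =>
  (∀ ε : ℝ, 0 < ε → ∃ m : Fin Nf → ℝ, (∀ fl, 0 < m fl) ∧ ∃ (f g : Fin Nf), f ≠ g ∧
    ∃ (R : ℝ) (p : ℕ) (C : ℝ), 0 < C ∧ ∃ᶠ k in atTop,
      ∃ (T : Finset (Literature.Probability.LatticeModels.Site 4)) (h : Literature.Probability.LatticeModels.Site 4 → ℝ)
        (n₁ n₂ : ℕ),
        1 ≤ n₁ ∧ n₁ < n₂ ∧ (n₂ : ℝ) * QCDRegularisation.a reg k ≤ R ∧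
        (∀ z ∈ T, z 0 = 0 ∧ ∀ i, |z i| ≤ (n₂ : ℤ)) ∧
        0 < ∑ z ∈ T, |h z| ∧
        0 < ‖zAP⟪QCDRegularisation.β reg k, QCDRegularisation.L reg k,
              fun fl => QCDRegularisation.mcrit reg k + QCDRegularisation.a reg k * m fl / QCDRegularisation.Zm reg k⟫‖ ∧
        C * QCDRegularisation.a reg k ^ p * ((∑ z ∈ T, |h z|) ^ 2 *
            ‖zAP⟪QCDRegularisation.β reg k, QCDRegularisation.L reg k,
              fun fl => QCDRegularisation.mcrit reg k + QCDRegularisation.a reg k * m fl / QCDRegularisation.Zm reg k⟫‖) ≤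
          ‖dAP⟪QCDRegularisation.β reg k, QCDRegularisation.L reg k,
              fun fl => QCDRegularisation.mcrit reg k + QCDRegularisation.a reg k * m fl / QCDRegularisation.Zm reg k,
              f, g, T, h, 2 * n₂⟫‖ ∧
        ‖dAP⟪QCDRegularisation.β reg k, QCDRegularisation.L reg k,
            fun fl => QCDRegularisation.mcrit reg k + QCDRegularisation.a reg k * m fl / QCDRegularisation.Zm reg k,
            f, g, T, h, 2 * n₁⟫‖ ≤
          ‖dAP⟪QCDRegularisation.β reg k, QCDRegularisation.L reg k,
              fun fl => QCDRegularisation.mcrit reg k + QCDRegularisation.a reg k * m fl / QCDRegularisation.Zm reg k,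
              f, g, T, h, 2 * n₂⟫‖ * Real.exp (ε * (QCDRegularisation.a reg k * ((n₂ : ℝ) - n₁))))


/-! ### (end of NOTATION PRELUDE — statements below must use these notations verbatim) -/

open Literature.MathematicalPhysics.QuantumLattice.GrassmannAlgebra WilsonRP

variable {Nf L : ℕ} [NeZero L]

/-- The quark relabelling by `u` translates the torus bilinear: `u · ψ̄_f(x)ΓMψ_g(y) = ψ̄_f(x+u)ΓMψ_g(y+u)`. -/
theorem quarkTranslate_torusBilinear (u : TorusSite 4 L) (f g : Fin Nf) (x y : TorusSite 4 L)
    (Γ : Matrix (Fin 4) (Fin 4) ℂ) (M : Matrix (Fin 3) (Fin 3) ℂ) :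
    quarkTranslate Nf u (torusBilinear f g x y Γ M) = torusBilinear f g (x + u) (y + u) Γ M := by
  simp only [torusBilinear, map_sum, map_smul, map_mul, quarkTranslate_qbar, quarkTranslate_q]

omit [NeZero L] in
/-- **Sign-twisted translation covariance of the time-antiperiodic Wilson–Dirac operator**: for a site
function `σ`, `σ² = 1`, constant along spatial shifts, with `σ(x) σ(x+e₀) apLinkSign(x−u) = apLinkSign(x)`,
`D_AP(τ_u U)_{pq} = σ(p) σ(q) D_AP(U)_{p−u,q−u}`. -/
theorem wilsonDiracAP_torusConfigShift_sign {N : ℕ} {G : Type*} [Group G] [MeasurableSpace G]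
    (ρ : G →* Matrix (Fin N) (Fin N) ℂ) (u : TorusSite 4 L) (σ : TorusSite 4 L → ℂ)
    (hσ1 : ∀ x, σ x * σ x = 1) (hσs : ∀ x (ν : Fin 4), ν ≠ 0 → σ (Site.shift x ν) = σ x)
    (hσ0 : ∀ x, σ x * σ (Site.shift x 0) * apLinkSign L (x - u) 0 = apLinkSign L x 0)
    (U : GaugeConfig 4 L G) (m r : ℝ) (p q : TorusSite 4 L × Fin N × Fin 4) :
    Literature.MathematicalPhysics.QuantumFieldTheory.wilsonDiracAP ρ (torusConfigShift u U) m r p q =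
      σ p.1 * σ q.1 *
        Literature.MathematicalPhysics.QuantumFieldTheory.wilsonDiracAP ρ U m r (p.1 - u, p.2) (q.1 - u, q.2) := by
  have hs : ∀ (x : TorusSite 4 L) (μ : Fin 4), Site.shift (x - u) μ = Site.shift x μ - u :=
    fun x μ => by simp only [Literature.MathematicalPhysics.QuantumFieldTheory.Site.shift, add_sub_right_comm]
  have hkey : ∀ (x : TorusSite 4 L) (ν : Fin 4),
      σ x * σ (Site.shift x ν) * apLinkSign L (x - u) ν = apLinkSign L x ν := by
    intro x ν
    by_cases hν : ν = 0
    · subst hν; exact hσ0 x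
    · rw [apLinkSign_of_ne_zero _ _ hν, apLinkSign_of_ne_zero _ _ hν, hσs x ν hν, hσ1, one_mul]
  obtain ⟨x, a, α⟩ := p; obtain ⟨y, b, β⟩ := q
  simp only [Literature.MathematicalPhysics.QuantumFieldTheory.wilsonDiracAP, Matrix.of_apply,
    torusConfigShift_apply, Prod.mk.injEq, hs, sub_left_inj, mul_sub, Finset.mul_sum, mul_add]
  congr 1
  · split_ifs with h
    · rcases h with ⟨rfl, -, -⟩
      rw [hσ1, one_mul]
    · rw [mul_zero]
  · refine Finset.sum_congr rfl fun ν _ => ?_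
    congr 1 <;> split_ifs with h
    · subst h; rw [← hkey x ν]; ring
    · rw [mul_zero, mul_zero]
    · subst h; rw [← hkey y ν]; ring
    · rw [mul_zero, mul_zero]

/-- **Sign-twisted translation covariance of the `N_f`-flavour antiperiodic Dirac matrix**
(`σ` as in `wilsonDiracAP_torusConfigShift_sign`, read at the site of the quark variable). -/
theorem diracMatrixAP_torusConfigShift_sign (u : TorusSite 4 L) (σ : TorusSite 4 L → ℂ)
    (hσ1 : ∀ x, σ x * σ x = 1) (hσs : ∀ x (ν : Fin 4), ν ≠ 0 → σ (Site.shift x ν) = σ x)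
    (hσ0 : ∀ x, σ x * σ (Site.shift x 0) * apLinkSign L (x - u) 0 = apLinkSign L x 0)
    (U : GaugeConfig 4 L SU3) (mq : Fin Nf → ℝ) (i j : FermiIdx Nf L) :
    diracMatrixAP (torusConfigShift u U) mq i j =
      σ (quarkEquiv.symm i).2.1 * σ (quarkEquiv.symm j).2.1 * diracMatrixAP U mq (quarkShift u i) (quarkShift u j) := by
  obtain ⟨⟨f, x, c⟩, rfl⟩ := quarkEquiv.surjective i; obtain ⟨⟨g, y, e⟩, rfl⟩ := quarkEquiv.surjective j
  rw [Equiv.symm_apply_apply, Equiv.symm_apply_apply, quarkShift_quarkEquiv, quarkShift_quarkEquiv,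
    diracMatrixAP_apply, diracMatrixAP_apply]
  dsimp only
  split_ifs with h
  · exact wilsonDiracAP_torusConfigShift_sign _ u σ hσ1 hσs hσ0 U _ 1 (x, c) (y, e)
  · rw [mul_zero]

section Flip

variable {R : Type*} [CommRing R] {ι : Type*} [LinearOrder ι] [Fintype ι]

/-- The diagonal block substitution rescales `ψ̄_i` by `ε_i`. -/
theorem map_blockSubst_diagonal_psiBar (ε : ι → R) (i : ι) :
    ExteriorAlgebra.map (blockSubst R (Matrix.diagonal ε) (Matrix.diagonal ε)) (psiBar R i) = ε i • psiBar R i := by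
  rw [map_blockSubst_psiBar]
  simp only [Matrix.diagonal_apply, ite_smul, zero_smul, Finset.sum_ite_eq', Finset.mem_univ, if_true]

/-- The diagonal block substitution rescales `ψ_i` by `ε_i`. -/
theorem map_blockSubst_diagonal_psi (ε : ι → R) (i : ι) :
    ExteriorAlgebra.map (blockSubst R (Matrix.diagonal ε) (Matrix.diagonal ε)) (psi R i) = ε i • psi R i := by
  rw [map_blockSubst_psi]
  simp only [Matrix.diagonal_apply, ite_smul, zero_smul, Finset.sum_ite_eq', Finset.mem_univ, if_true]

/-- **Unit Berezin Jacobian**: for `ε_i² = 1` the diagonal substitution has determinant `(∏ ε)² = 1`. -/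
theorem det_blockSubst_diagonal (ε : ι → R) (hε : ∀ i, ε i * ε i = 1) :
    LinearMap.det (blockSubst R (Matrix.diagonal ε) (Matrix.diagonal ε)) = 1 := by
  rw [det_blockSubst, Matrix.det_diagonal, ← Finset.prod_mul_distrib]
  exact Finset.prod_eq_one fun i _ => hε i

/-- The diagonal substitution conjugates the action: `e^{ψ̄ A ψ} ↦ e^{ψ̄ (εAε) ψ}`. -/
theorem map_blockSubst_diagonal_grassmannExp_quadratic [Algebra ℚ R] (ε : ι → R) (A : Matrix ι ι R) :
    ExteriorAlgebra.map (blockSubst R (Matrix.diagonal ε) (Matrix.diagonal ε)) (grassmannExp (quadratic R A)) =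
      grassmannExp (quadratic R (Matrix.of fun i j => ε i * ε j * A i j)) := by
  rw [map_blockSubst_grassmannExp_quadratic, Matrix.diagonal_transpose]
  congr 2; ext i j
  rw [Matrix.mul_diagonal, Matrix.diagonal_mul, Matrix.of_apply]; ring

end Flip

/-- **The antiperiodic Boltzmann factor of the translated field** is the flipped translate:
`e^{−ψ̄ D_AP(τ_u U) ψ} = Φ_σ (u · e^{−ψ̄ D_AP(U) ψ})`. -/
theorem fermiBoltzmannAP_torusConfigShift_sign (u : TorusSite 4 L) (σ : TorusSite 4 L → ℂ)
    (hσ1 : ∀ x, σ x * σ x = 1) (hσs : ∀ x (ν : Fin 4), ν ≠ 0 → σ (Site.shift x ν) = σ x)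
    (hσ0 : ∀ x, σ x * σ (Site.shift x 0) * apLinkSign L (x - u) 0 = apLinkSign L x 0)
    (U : GaugeConfig 4 L SU3) (mq : Fin Nf → ℝ) :
    fermiBoltzmannAP (torusConfigShift u U) mq =
      ExteriorAlgebra.map (blockSubst ℂ (Matrix.diagonal fun i : FermiIdx Nf L => σ (quarkEquiv.symm i).2.1)
          (Matrix.diagonal fun i : FermiIdx Nf L => σ (quarkEquiv.symm i).2.1))
        (quarkTranslate Nf u (fermiBoltzmannAP U mq)) := by
  have key : ∀ a : FermiAlg Nf L, quarkTranslate Nf u (grassmannExp a) = grassmannExp (quarkTranslate Nf u a) :=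
    fun a => map_funLeft_grassmannExp ℂ (quarkTranslateEquiv Nf u) a
  rw [fermiBoltzmannAP, fermiBoltzmannAP, key, quarkTranslate_quadratic,
    map_blockSubst_diagonal_grassmannExp_quadratic]
  congr 2; ext i j
  rw [Matrix.neg_apply, Matrix.of_apply, Matrix.submatrix_apply, Matrix.neg_apply,
    diracMatrixAP_torusConfigShift_sign u σ hσ1 hσs hσ0]; ring

/-- **The flip fixes every equal-site bilinear** (`σ(x)² = 1`). -/
theorem map_blockSubst_diagonal_torusBilinear (σ : TorusSite 4 L → ℂ) (hσ1 : ∀ x, σ x * σ x = 1)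
    (f g : Fin Nf) (x : TorusSite 4 L) (Γ : Matrix (Fin 4) (Fin 4) ℂ) (M : Matrix (Fin 3) (Fin 3) ℂ) :
    ExteriorAlgebra.map (blockSubst ℂ (Matrix.diagonal fun i : FermiIdx Nf L => σ (quarkEquiv.symm i).2.1)
        (Matrix.diagonal fun i : FermiIdx Nf L => σ (quarkEquiv.symm i).2.1)) (torusBilinear f g x x Γ M) =
      torusBilinear f g x x Γ M := by
  simp only [torusBilinear, map_sum, map_smul, map_mul, qbar, q, map_blockSubst_diagonal_psiBar,
    map_blockSubst_diagonal_psi, Equiv.symm_apply_apply, smul_mul_smul_comm, hσ1, one_smul]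

/-- **The flip has unit Berezin Jacobian**: `∫dψ̄dψ Φ_σ(a) = ∫dψ̄dψ a`. -/
theorem fermiIntegral_map_blockSubst_diagonal (σ : TorusSite 4 L → ℂ) (hσ1 : ∀ x, σ x * σ x = 1)
    (a : FermiAlg Nf L) :
    fermiIntegral (ExteriorAlgebra.map
        (blockSubst ℂ (Matrix.diagonal fun i : FermiIdx Nf L => σ (quarkEquiv.symm i).2.1)
          (Matrix.diagonal fun i : FermiIdx Nf L => σ (quarkEquiv.symm i).2.1)) a) = fermiIntegral a := by
  rw [fermiIntegral]; exact berezin_map_of_det_eq_one ℂ (det_blockSubst_diagonal _ fun i => hσ1 _) a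

/-- **Invariance of the un-normalised antiperiodic two-bilinear functional under ONE translation `u`
admitting a sign cocycle `σ`** (substitute `U ↦ τ_u U`, relabel the quarks by `u`, flip by `σ`). -/
theorem integral_twoBilinearAP_translate_of_sign (β : ℝ) (mq : Fin Nf → ℝ) (u : TorusSite 4 L)
    (σ : TorusSite 4 L → ℂ) (hσ1 : ∀ x, σ x * σ x = 1)
    (hσs : ∀ x (ν : Fin 4), ν ≠ 0 → σ (Site.shift x ν) = σ x)
    (hσ0 : ∀ x, σ x * σ (Site.shift x 0) * apLinkSign L (x - u) 0 = apLinkSign L x 0)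
    (f g f' g' : Fin Nf) (Γ Γ' : Matrix (Fin 4) (Fin 4) ℂ) (x y : TorusSite 4 L) :
    ∫ U : GaugeConfig 4 L SU3,
        fermiIntegral (torusBilinear f g (x + u) (x + u) Γ 1 * torusBilinear f' g' (y + u) (y + u) Γ' 1 *
          fermiBoltzmannAP U mq) ∂(wilsonMeasure (fundamentalRep (Fin 3)) β) =
      ∫ U : GaugeConfig 4 L SU3,
        fermiIntegral (torusBilinear f g x x Γ 1 * torusBilinear f' g' y y Γ' 1 * fermiBoltzmannAP U mq)
          ∂(wilsonMeasure (fundamentalRep (Fin 3)) β) := by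
  rw [← integral_comp_torusConfigShift_wilson β u (fun U : GaugeConfig 4 L SU3 =>
    fermiIntegral (torusBilinear f g (x + u) (x + u) Γ 1 * torusBilinear f' g' (y + u) (y + u) Γ' 1 *
      fermiBoltzmannAP U mq))]
  refine integral_congr_ae (Filter.Eventually.of_forall fun U => ?_)
  simp only
  rw [fermiBoltzmannAP_torusConfigShift_sign u σ hσ1 hσs hσ0 U mq,
    ← map_blockSubst_diagonal_torusBilinear σ hσ1 f g (x + u) Γ 1,
    ← map_blockSubst_diagonal_torusBilinear σ hσ1 f' g' (y + u) Γ' 1,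
    ← quarkTranslate_torusBilinear u f g x x Γ 1, ← quarkTranslate_torusBilinear u f' g' y y Γ' 1,
    ← map_mul, ← map_mul, ← map_mul, ← map_mul, fermiIntegral_map_blockSubst_diagonal σ hσ1,
    fermiIntegral_quarkTranslate]

omit [NeZero L] in
/-- `apLinkSign² = 1`. -/
theorem apLinkSign_mul_self (x : TorusSite 4 L) (μ : Fin 4) : apLinkSign L x μ * apLinkSign L x μ = 1 := by
  unfold apLinkSign; split_ifs <;> norm_num

/-- **Unit translations**: spatial ones carry no sign (`σ ≡ 1`); for the temporal one the cocycle is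
`σ(x) = apLinkSign(x − e₀)` (the slice just above the antiperiodic layer is flipped). -/
theorem integral_twoBilinearAP_translate_single (β : ℝ) (mq : Fin Nf → ℝ) (μ : Fin 4)
    (f g f' g' : Fin Nf) (Γ Γ' : Matrix (Fin 4) (Fin 4) ℂ) (x y : TorusSite 4 L) :
    ∫ U : GaugeConfig 4 L SU3,
        fermiIntegral (torusBilinear f g (x + Pi.single μ 1) (x + Pi.single μ 1) Γ 1 *
          torusBilinear f' g' (y + Pi.single μ 1) (y + Pi.single μ 1) Γ' 1 * fermiBoltzmannAP U mq)
          ∂(wilsonMeasure (fundamentalRep (Fin 3)) β) =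
      ∫ U : GaugeConfig 4 L SU3,
        fermiIntegral (torusBilinear f g x x Γ 1 * torusBilinear f' g' y y Γ' 1 * fermiBoltzmannAP U mq)
          ∂(wilsonMeasure (fundamentalRep (Fin 3)) β) := by
  by_cases hμ : μ = 0
  · subst hμ
    refine integral_twoBilinearAP_translate_of_sign β mq (Pi.single 0 1)
      (fun z => apLinkSign L (z - Pi.single 0 1) 0) (fun z => apLinkSign_mul_self _ _) (fun z ν hν => ?_)
      (fun z => ?_) f g f' g' Γ Γ' x y
    · have h0 : (Site.shift z ν - (Pi.single 0 1 : TorusSite 4 L)) 0 = (z - (Pi.single 0 1 : TorusSite 4 L)) 0 := by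
        rw [Pi.sub_apply, Pi.sub_apply, shift_apply_of_ne z (Ne.symm hν)]
      simp only [apLinkSign, h0]
    · have hz : Site.shift z 0 - Pi.single 0 1 = z := by
        rw [Literature.MathematicalPhysics.QuantumFieldTheory.Site.shift, add_sub_cancel_right]
      simp only [hz]
      rw [mul_right_comm, apLinkSign_mul_self, one_mul]
  · refine integral_twoBilinearAP_translate_of_sign β mq (Pi.single μ 1) (fun _ => 1) (fun _ => one_mul 1)
      (fun _ _ _ => rfl) (fun z => ?_) f g f' g' Γ Γ' x y
    have h0 : (z - (Pi.single μ 1 : TorusSite 4 L)) 0 = z 0 := by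
      rw [Pi.sub_apply, Pi.single_eq_of_ne (Ne.symm hμ), sub_zero]
    simp only [one_mul, apLinkSign, h0]

/-- **Stub 1 · translation invariance of the un-normalised antiperiodic two-bilinear functional** on the odd
torus `2S+1` (every `β`, all masses, all flavours and spin matrices): translating both equal-site bilinears by
`u` does not change `∫dμ_W ∫dψ̄dψ (ψ̄_f Γ ψ_g)(x) (ψ̄_{f'} Γ' ψ_{g'})(y) e^{−ψ̄ D_AP(U) ψ}`.  The invariant
translations are closed under `+` and contain the units (`integral_twoBilinearAP_translate_single`), and
`u = Σ_μ (u μ).val • e_μ`. -/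
theorem stub_apTranslation : ∀ Nf : ℕ, APTI⟪Nf⟫ := by
  intro Nf β S mq f g f' g' Γ Γ' x y u
  set I : TorusSite 4 (2 * S + 1) → TorusSite 4 (2 * S + 1) → ℂ := fun x y =>
    ∫ U : GaugeConfig 4 (2 * S + 1) SU3,
      fermiIntegral (torusBilinear f g x x Γ 1 * torusBilinear f' g' y y Γ' 1 * fermiBoltzmannAP U mq)
        ∂(wilsonMeasure (fundamentalRep (Fin 3)) β) with hI
  change I x y = I (x + u) (y + u)
  have hP0 : ∀ x y : TorusSite 4 (2 * S + 1), I x y = I (x + 0) (y + 0) := fun x y => by rw [add_zero, add_zero]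
  have hPadd : ∀ v w : TorusSite 4 (2 * S + 1), (∀ x y, I x y = I (x + v) (y + v)) →
      (∀ x y, I x y = I (x + w) (y + w)) → ∀ x y, I x y = I (x + (v + w)) (y + (v + w)) :=
    fun v w hv hw x y => by rw [hv x y, hw (x + v) (y + v), add_assoc, add_assoc]
  have hPn : ∀ (n : ℕ) (μ : Fin 4) (x y : TorusSite 4 (2 * S + 1)),
      I x y = I (x + n • (Pi.single μ 1 : TorusSite 4 (2 * S + 1))) (y + n • (Pi.single μ 1 : TorusSite 4 (2 * S + 1))) := by
    intro n μ; induction n with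
    | zero => simpa only [zero_smul] using hP0
    | succ n ih =>
      intro x y; rw [succ_nsmul]
      exact hPadd _ _ ih (fun x y => (integral_twoBilinearAP_translate_single β mq μ f g f' g' Γ Γ' x y).symm) x y
  have hu : u = ∑ μ : Fin 4, (u μ).val • (Pi.single μ 1 : TorusSite 4 (2 * S + 1)) :=
    calc u = ∑ μ : Fin 4, Pi.single μ (u μ) := (Finset.univ_sum_single u).symm
      _ = ∑ μ : Fin 4, (u μ).val • (Pi.single μ 1 : TorusSite 4 (2 * S + 1)) :=
          Finset.sum_congr rfl fun μ _ => by rw [← Pi.single_smul, nsmul_one, ZMod.natCast_zmod_val]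
  rw [hu]
  exact Finset.sum_induction (fun μ : Fin 4 => (u μ).val • (Pi.single μ 1 : TorusSite 4 (2 * S + 1)))
    (fun v => ∀ x y, I x y = I (x + v) (y + v)) hPadd hP0 (fun μ _ => hPn _ μ) x y

end Summit.QuantumFields.QCD.Cruxes.ChiralOneScaleTrajectory.LogConvexLift.APTranslation

end
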